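/-
Copyright: the b2b-balaban T⁴-continuum CRUX team, row NE7b OWNER lineage `t4-ne7b-p1` (gen 129). Project licence.
-/
import Summits.QuantumFields.BalabanUV.T4Continuum.Spine.NE7b.SupActivityPolymerGas

/-!
# THE EFFECTIVE ACTION IS A SUM OF SMALL LOCAL TERMS UP TO AN EXPONENTIALLY SMALL EXTENSIVE REMAINDER: with the Kotecký–Preiss DECAY
# weight `τ·#Y` (smallness `e^{1+τ}ε(Δ+1)² ≤ 1∕2`), the pinned cluster sums carry the weight — `Σ_{𝒞 pinned at X}‖Φ^T(𝒞)‖e^{τ‖𝒞‖} ≤ #X(Δ+1)2e^{1+τ}ε`,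
# `‖𝒞‖ = Σ_{Y∈𝒞}#Y` — so clusters of total size `≥ m` weigh `≤ e^{−τm}` times that, and
#   `‖log Z(C) − Σ_{𝒞 ⊆ 𝒫(C), ‖𝒞‖ < m} Φ^T(𝒞)‖ ≤ #C·(Δ+1)·2e^{1+τ}ε·e^{−τm}`:
# `log Z(C)` is the sum of the cluster terms of size `< m` (each a functional of the activities of fewer than `m` cells) plus an extensive
# remainder exponentially small in `m` (row NE7b, node U5c; the tree's KP derivative bound `touchSum_le_of_forall_scaleAt` with decay weight
# and `geomInc_kp_sum_le` at `τ ≥ 0`, (287)'s activity-level layer BY NAME; [folklore])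

Cell `pub-balaban`, sub-cell `t4`, spine estimate NE7b (`T4WeightBudget.RelWeightBound`; the cell's OWN estimate — NOT PRINTED in
[Bałaban 1983–89], NOT PROVED).  Crux-route work under `Spine/NE7b/` by the row OWNER (`t4-ne7b-p1` gen 129, file (312)) under FREEZE
(0)'s crux-prover clause, on § [NE7bP1-G128-HANDOFF] NEXT (3)(c) (what the ITERATION consumes: a LOCAL form of the effective action);
NOTHING of Bałaban's is named as a Lean object, valued or asserted; no `T4Continuum/Support` leaf typed; no `def`, no notation; zero `sorry`.
Imports (BY NAME): the OWNER's (287) `…SupActivityPolymerGas` (`act_connActivity_eq_zero`, `act_norm_connActivity_le`,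
`act_isKPVolume_connActivity`); the tree's `LocalPerturbationClusterExpansion` (`geomInc_kp_sum_le`, `geomInc_kp_hypothesis`,
`pertLogZ_eq_sum_truncatedWeight`, `exists_kpTouches_singleton`), `ClusterExpansionKPBound` (`touchSum`, `touchSum_le_of_forall_scaleAt`,
`touchSum_smul_le_of_kp`, `multCube`, `mem_multCube`), `ClusterExpansionActivityPaths` (`scaledActivity_one`, `scaleAt_mem_Icc`),
`truncatedWeight_congr`; Mathlib's `Real.exp_le_exp`, `Finset.sum_filter_add_sum_filter_not`.

WHY (located).  (311) proved locality as a Lipschitz bound under local changes of the factors; the iteration of a renormalisation-group map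
wants more — the effective action WRITTEN as a sum of local pieces.  The cluster expansion is such a sum, but over clusters of all sizes; the
Kotecký–Preiss condition with the decay weight `d(Y) = τ#Y` (the tree proves the geometric polymers satisfy it under `e^{1+τ}ε(Δ+1)² ≤ 1∕2`)
makes the large clusters exponentially rare, so truncating at total size `m` leaves local terms on fewer than `m` cells and an error
`O(ε·#C·e^{−τm})`.  This is the form in which «`−log Z_ψ` is again a local action» is used.

WHAT IS PROVED ([folklore]; activity level as in (287): `R` symmetric with `≤ Δ` neighbours, `‖M(K)‖ ≤ ε^{#K}` on `R`-connected `K`, `0 ≤ ε`,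
`0 ≤ τ`, `e^{1+τ}ε(Δ+1)² ≤ 1∕2`; `‖𝒞‖ = Σ_{Y∈𝒞}#Y`):
* §1 `smallness_of_decay` (`e^{1+τ}ε(Δ+1)² ≤ 1∕2 ⟹ eε(Δ+1)² ≤ 1∕2`), **`act_touchSum_decay_le`** (the `τ`-WEIGHTED pinned cluster sums:
  `Σ_{𝒞 ⊆ 𝒫(C) pinned at X}‖Φ^T(𝒞)‖e^{τ‖𝒞‖} ≤ #X(Δ+1)2e^{1+τ}ε`);
* §2 **`act_sum_norm_truncatedWeight_large_pinned_le`** (`Σ_{pinned at X, ‖𝒞‖ ≥ m}‖Φ^T(𝒞)‖ ≤ e^{−τm}·#X(Δ+1)2e^{1+τ}ε`),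
  **`act_sum_norm_truncatedWeight_large_le`** (`Σ_{𝒞 ⊆ 𝒫(C), ‖𝒞‖ ≥ m}‖Φ^T(𝒞)‖ ≤ e^{−τm}·#C(Δ+1)2e^{1+τ}ε`);
* §3 THE END **`act_norm_pertLogZ_sub_smallClusters_le`** (`‖log Z(C) − Σ_{‖𝒞‖ < m}Φ^T(𝒞)‖ ≤ e^{−τm}·#C(Δ+1)2e^{1+τ}ε`) and
  **`smallClusters_congr`** (the retained sum depends only on the activities of the `R`-connected `K ⊆ C` with `#K < m`); §4 toy.

HONEST (what this is NOT).  The abstract activity-level statement (the road's regulated∕shifted instances follow by (289)∕(296)'s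
dictionaries exactly as (287) ⟶ (289) and are not repeated); total cluster SIZE, not diameter (a distance on cells is not introduced);
scalar skeleton ((A3), NC-NE7b-α UNRULED); nothing of Bałaban's asserted.  BY-NAME EFFECT ON THE WALL: NONE.  NE7b NOT PRINTED ∕ NOT PROVED;
spine PROVED 0∕9; rung (B)+1 — the programme's measures remain FINITE-torus statements; NOT the mass gap, NOT Clay.  HONEST DEPENDENCY:
continuum YM on T⁴ ⇐ BetaPertH ∧ nine spine estimates (0∕9 proved); BetaPertH ⇐ (D1) ∧ (D4) ∧ CAP+tail; G-an2-4 gates asym, D1 and NE2∕3∕4.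
-/

set_option autoImplicit false

noncomputable section

namespace Summit.QuantumFields.BalabanUV.T4Continuum.NE7b.SupEffectiveActionLocalExpansion

open MeasureTheory ProbabilityTheory Finset Real
open scoped BigOperators
open Literature.Probability.LatticeModels

variable {V : Type*} [DecidableEq V] {Ω : Type*} {mΩ : MeasurableSpace Ω} {μ : Measure Ω} {R : V → V → Prop} [DecidableRel R]
  {g g' : V → Ω → ℂ} {ε τ : ℝ} {nbr : V → Finset V} {Δ : ℕ}

/-! ## §1. The `τ`-weighted pinned cluster sums -/

omit [DecidableEq V] [DecidableRel R] in
/-- The decay-weighted smallness implies the plain one: `0 ≤ τ`, `e^{1+τ}ε(Δ+1)² ≤ 1∕2 ⟹ eε(Δ+1)² ≤ 1∕2`. [folklore] -/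
theorem smallness_of_decay (hε : 0 ≤ ε) (hτ : 0 ≤ τ) (hsmall : Real.exp (1 + τ) * ε * ((Δ : ℝ) + 1) ^ 2 ≤ 1 / 2) :
    Real.exp 1 * ε * ((Δ : ℝ) + 1) ^ 2 ≤ 1 / 2 := by
  have h1 : Real.exp 1 ≤ Real.exp (1 + τ) := exp_le_exp.2 (by linarith)
  have h2 : 0 ≤ ε * ((Δ : ℝ) + 1) ^ 2 := by positivity
  nlinarith

/-- **THE `τ`-WEIGHTED PINNED CLUSTER SUMS ARE `O(ε)`**: `R` symmetric with `≤ Δ` neighbours, `‖M(K)‖ ≤ ε^{#K}` on `R`-connected `K`,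
`0 ≤ ε`, `0 ≤ τ`, `e^{1+τ}ε(Δ+1)² ≤ 1∕2` ⟹ for every cell set `X`,
`Σ_{𝒞 ⊆ 𝒫(C), 𝒞 pinned at X} ‖Φ^T(𝒞)‖·e^{τΣ_{Y∈𝒞}#Y} ≤ #X·(Δ+1)·2e^{1+τ}ε` ([KP86, (4)] with `d(Y) = τ#Y`). [folklore] -/
theorem act_touchSum_decay_le (hR : ∀ x y, R x y → R y x) (hΔ : ∀ x, (nbr x).card ≤ Δ) (hnbr : ∀ x y, R x y → y ∈ nbr x)
    (hact : ∀ K : Finset V, IsRConnected R K → ‖cellActivity μ g K‖ ≤ ε ^ K.card) (hε : 0 ≤ ε) (hτ : 0 ≤ τ)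
    (hsmall : Real.exp (1 + τ) * ε * ((Δ : ℝ) + 1) ^ 2 ≤ 1 / 2) (C X : Finset V) :
    ∑ 𝒞 ∈ (rconnSubsets R C).powerset with KPTouches (GeomInc R) 𝒞 X,
        ‖truncatedWeight (GeomInc R) (connActivity R μ g) 𝒞‖ * Real.exp (∑ Y ∈ 𝒞, τ * (Y.card : ℝ))
      ≤ X.card * ((Δ : ℝ) + 1) * (2 * (Real.exp (1 + τ) * ε)) := by
  haveI : Std.Symm R := ⟨hR⟩
  set L := rconnSubsets R C with hL
  set w := connActivity R μ g with hw
  have hz0 : ∀ Y, ¬ IsRConnected R Y → w Y = 0 := fun Y hY => SupActivityPolymerGas.act_connActivity_eq_zero Y hY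
  have hz : ∀ Y, ‖w Y‖ ≤ ε ^ Y.card := fun Y => SupActivityPolymerGas.act_norm_connActivity_le hact hε Y
  have h1 : ∀ γ ∈ L, ∑ γ' ∈ L with GeomInc R γ' γ,
      ‖w γ'‖ * Real.exp ((γ'.card : ℝ) + (fun Y : Finset V => τ * (Y.card : ℝ)) γ') ≤ (γ.card : ℝ) := by
    intro γ hγ
    have := geomInc_kp_hypothesis hR hΔ hnbr hε hsmall w hz0 hz L γ hγ
    simpa using this
  have ha : ∀ γ : Finset V, 0 ≤ (γ.card : ℝ) := fun γ => Nat.cast_nonneg _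
  have hd : ∀ γ : Finset V, 0 ≤ (fun Y : Finset V => τ * (Y.card : ℝ)) γ := fun γ => by positivity
  have hKP : IsKPVolume (GeomInc R) w (fun X => (X.card : ℝ)) L :=
    SupActivityPolymerGas.act_isKPVolume_connActivity hR hΔ hnbr hact hε (smallness_of_decay hε hτ hsmall) L
  have hS : ∀ t ∈ Set.Icc (0 : ℝ) 1, ∀ δ ∈ L, GeomInc R δ X →
      touchSum (GeomInc R) (scaledActivity w (scaleAt (GeomInc R) (fun _ => (1 : ℝ)) X t)) (fun Y : Finset V => τ * (Y.card : ℝ)) L δ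
        ≤ (δ.card : ℝ) := by
    intro t ht δ hδ _
    have hc : scaleAt (GeomInc R) (fun _ => (1 : ℝ)) X t ∈ multCube (Finset V) 1 :=
      mem_multCube.2 fun δ' => scaleAt_mem_Icc (fun _ => ⟨zero_le_one, le_rfl⟩) X ht δ'
    have := touchSum_smul_le_of_kp ha hd h1 1 ⟨zero_le_one, le_rfl⟩ _ hc δ hδ
    rwa [one_smul] at this
  have hmain := touchSum_le_of_forall_scaleAt (inc := GeomInc R) hd hKP (c := fun _ => (1 : ℝ)) (fun _ => ⟨zero_le_one, le_rfl⟩)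
    (γ := X) hS
  rw [scaledActivity_one] at hmain
  have hlhs : touchSum (GeomInc R) w (fun Y : Finset V => τ * (Y.card : ℝ)) L X =
      ∑ 𝒞 ∈ L.powerset with KPTouches (GeomInc R) 𝒞 X, ‖truncatedWeight (GeomInc R) w 𝒞‖ * Real.exp (∑ Y ∈ 𝒞, τ * (Y.card : ℝ)) := rfl
  rw [hlhs] at hmain
  refine hmain.trans ?_
  exact geomInc_kp_sum_le hR hΔ hnbr hε hsmall w hz0 hz X (L.filter fun Y => GeomInc R Y X) fun Y hY => (mem_filter.1 hY).2

/-! ## §2. Large clusters are exponentially rare -/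

/-- **LARGE CLUSTERS PINNED AT `X` ARE EXPONENTIALLY RARE**: under the hypotheses of `act_touchSum_decay_le`,
`Σ_{𝒞 pinned at X, m ≤ ‖𝒞‖} ‖Φ^T(𝒞)‖ ≤ e^{−τm}·#X(Δ+1)2e^{1+τ}ε`, `‖𝒞‖ = Σ_{Y∈𝒞}#Y`. [folklore] -/
theorem act_sum_norm_truncatedWeight_large_pinned_le (hR : ∀ x y, R x y → R y x) (hΔ : ∀ x, (nbr x).card ≤ Δ)
    (hnbr : ∀ x y, R x y → y ∈ nbr x) (hact : ∀ K : Finset V, IsRConnected R K → ‖cellActivity μ g K‖ ≤ ε ^ K.card) (hε : 0 ≤ ε)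
    (hτ : 0 ≤ τ) (hsmall : Real.exp (1 + τ) * ε * ((Δ : ℝ) + 1) ^ 2 ≤ 1 / 2) (C X : Finset V) (m : ℝ) :
    ∑ 𝒞 ∈ (rconnSubsets R C).powerset with KPTouches (GeomInc R) 𝒞 X ∧ m ≤ ∑ Y ∈ 𝒞, (Y.card : ℝ),
        ‖truncatedWeight (GeomInc R) (connActivity R μ g) 𝒞‖
      ≤ Real.exp (-(τ * m)) * (X.card * ((Δ : ℝ) + 1) * (2 * (Real.exp (1 + τ) * ε))) := by
  have h := act_touchSum_decay_le (μ := μ) hR hΔ hnbr hact hε hτ hsmall C X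
  -- on the large clusters `e^{τ‖𝒞‖} ≥ e^{τm}`
  have hstep : Real.exp (τ * m) * ∑ 𝒞 ∈ (rconnSubsets R C).powerset with KPTouches (GeomInc R) 𝒞 X ∧ m ≤ ∑ Y ∈ 𝒞, (Y.card : ℝ),
      ‖truncatedWeight (GeomInc R) (connActivity R μ g) 𝒞‖ ≤
      ∑ 𝒞 ∈ (rconnSubsets R C).powerset with KPTouches (GeomInc R) 𝒞 X,
        ‖truncatedWeight (GeomInc R) (connActivity R μ g) 𝒞‖ * Real.exp (∑ Y ∈ 𝒞, τ * (Y.card : ℝ)) := by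
    rw [mul_sum]
    calc ∑ 𝒞 ∈ (rconnSubsets R C).powerset with KPTouches (GeomInc R) 𝒞 X ∧ m ≤ ∑ Y ∈ 𝒞, (Y.card : ℝ),
          Real.exp (τ * m) * ‖truncatedWeight (GeomInc R) (connActivity R μ g) 𝒞‖
        ≤ ∑ 𝒞 ∈ (rconnSubsets R C).powerset with KPTouches (GeomInc R) 𝒞 X ∧ m ≤ ∑ Y ∈ 𝒞, (Y.card : ℝ),
          ‖truncatedWeight (GeomInc R) (connActivity R μ g) 𝒞‖ * Real.exp (∑ Y ∈ 𝒞, τ * (Y.card : ℝ)) := by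
          refine sum_le_sum fun 𝒞 h𝒞 => ?_
          obtain ⟨-, -, hm⟩ := mem_filter.1 h𝒞
          rw [mul_comm]
          refine mul_le_mul_of_nonneg_left (exp_le_exp.2 ?_) (norm_nonneg _)
          rw [← mul_sum]
          exact mul_le_mul_of_nonneg_left hm hτ
      _ ≤ _ := sum_le_sum_of_subset_of_nonneg (fun 𝒞 h𝒞 => by
            simp only [mem_filter] at h𝒞 ⊢
            exact ⟨h𝒞.1, h𝒞.2.1⟩) fun _ _ _ => by positivity
  have hexp : 0 < Real.exp (τ * m) := exp_pos _
  rw [Real.exp_neg, ← div_eq_inv_mul, le_div_iff₀ hexp, mul_comm]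
  exact hstep.trans h

/-- **LARGE CLUSTERS ARE EXPONENTIALLY RARE, EXTENSIVELY**: under the hypotheses of `act_touchSum_decay_le`,
`Σ_{𝒞 ⊆ 𝒫(C), m ≤ ‖𝒞‖} ‖Φ^T(𝒞)‖ ≤ e^{−τm}·#C(Δ+1)2e^{1+τ}ε` for `0 < m` (every nonempty cluster is pinned at a singleton of `C`).
[folklore] -/
theorem act_sum_norm_truncatedWeight_large_le (hR : ∀ x y, R x y → R y x) (hΔ : ∀ x, (nbr x).card ≤ Δ)
    (hnbr : ∀ x y, R x y → y ∈ nbr x) (hact : ∀ K : Finset V, IsRConnected R K → ‖cellActivity μ g K‖ ≤ ε ^ K.card) (hε : 0 ≤ ε)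
    (hτ : 0 ≤ τ) (hsmall : Real.exp (1 + τ) * ε * ((Δ : ℝ) + 1) ^ 2 ≤ 1 / 2) (C : Finset V) {m : ℝ} (hm : 0 < m) :
    ∑ 𝒞 ∈ (rconnSubsets R C).powerset with m ≤ ∑ Y ∈ 𝒞, (Y.card : ℝ), ‖truncatedWeight (GeomInc R) (connActivity R μ g) 𝒞‖
      ≤ Real.exp (-(τ * m)) * (C.card * ((Δ : ℝ) + 1) * (2 * (Real.exp (1 + τ) * ε))) := by
  classical
  set L := rconnSubsets R C with hL
  set Φ : Finset (Finset V) → ℂ := truncatedWeight (GeomInc R) (connActivity R μ g) with hΦ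
  -- a large cluster is nonempty, hence pinned at some `{p}`, `p ∈ C`
  calc ∑ 𝒞 ∈ L.powerset with m ≤ ∑ Y ∈ 𝒞, (Y.card : ℝ), ‖Φ 𝒞‖
      ≤ ∑ 𝒞 ∈ L.powerset with m ≤ ∑ Y ∈ 𝒞, (Y.card : ℝ), ∑ p ∈ C with KPTouches (GeomInc R) 𝒞 {p}, ‖Φ 𝒞‖ := by
        refine sum_le_sum fun 𝒞 h𝒞 => ?_
        obtain ⟨h𝒞L, hm𝒞⟩ := mem_filter.1 h𝒞
        have hne : 𝒞.Nonempty := by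
          by_contra hnot
          rw [not_nonempty_iff_eq_empty.1 hnot, sum_empty] at hm𝒞
          linarith
        obtain ⟨p, hpC, hp⟩ := exists_kpTouches_singleton (mem_powerset.1 h𝒞L) hne
        have hmem : p ∈ C.filter fun p => KPTouches (GeomInc R) 𝒞 {p} := mem_filter.2 ⟨hpC, hp⟩
        calc ‖Φ 𝒞‖ = ∑ q ∈ ({p} : Finset V), ‖Φ 𝒞‖ := by simp
          _ ≤ _ := sum_le_sum_of_subset_of_nonneg (by simpa using hmem) fun _ _ _ => norm_nonneg _
    _ = ∑ p ∈ C, ∑ 𝒞 ∈ (L.powerset.filter fun 𝒞 => m ≤ ∑ Y ∈ 𝒞, (Y.card : ℝ)) with KPTouches (GeomInc R) 𝒞 {p}, ‖Φ 𝒞‖ := by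
        rw [sum_comm' (t' := C) (s' := fun p => (L.powerset.filter fun 𝒞 => m ≤ ∑ Y ∈ 𝒞, (Y.card : ℝ)).filter
          fun 𝒞 => KPTouches (GeomInc R) 𝒞 {p})]
        intro 𝒞 p
        simp only [mem_filter]
        tauto
    _ = ∑ p ∈ C, ∑ 𝒞 ∈ L.powerset with KPTouches (GeomInc R) 𝒞 {p} ∧ m ≤ ∑ Y ∈ 𝒞, (Y.card : ℝ), ‖Φ 𝒞‖ := by
        refine sum_congr rfl fun p _ => ?_
        rw [filter_filter]
        refine sum_congr (filter_congr fun 𝒞 _ => and_comm) fun _ _ => rfl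
    _ ≤ ∑ p ∈ C, Real.exp (-(τ * m)) * ((({p} : Finset V).card : ℝ) * ((Δ : ℝ) + 1) * (2 * (Real.exp (1 + τ) * ε))) :=
        sum_le_sum fun p _ => act_sum_norm_truncatedWeight_large_pinned_le hR hΔ hnbr hact hε hτ hsmall C {p} m
    _ = Real.exp (-(τ * m)) * (C.card * ((Δ : ℝ) + 1) * (2 * (Real.exp (1 + τ) * ε))) := by
        simp only [card_singleton, Nat.cast_one, one_mul, sum_const, nsmul_eq_mul]
        ring

/-! ## §3. THE END: the local expansion with an exponentially small remainder -/

/-- **THE END — THE EFFECTIVE ACTION IS THE SUM OF ITS SMALL CLUSTERS UP TO AN EXPONENTIALLY SMALL EXTENSIVE REMAINDER.**  `R` symmetric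
with `≤ Δ` neighbours, `‖M(K)‖ ≤ ε^{#K}` on `R`-connected `K`, `0 ≤ ε`, `0 ≤ τ`, `e^{1+τ}ε(Δ+1)² ≤ 1∕2`, `0 < m` ⟹
`‖log Z(C) − Σ_{𝒞 ⊆ 𝒫(C), ‖𝒞‖ < m} Φ^T(𝒞)‖ ≤ e^{−τm}·#C·(Δ+1)·2e^{1+τ}ε`, `‖𝒞‖ = Σ_{Y∈𝒞}#Y`, uniformly in the volume. [folklore] -/
theorem act_norm_pertLogZ_sub_smallClusters_le (hR : ∀ x y, R x y → R y x) (hΔ : ∀ x, (nbr x).card ≤ Δ)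
    (hnbr : ∀ x y, R x y → y ∈ nbr x) (hact : ∀ K : Finset V, IsRConnected R K → ‖cellActivity μ g K‖ ≤ ε ^ K.card) (hε : 0 ≤ ε)
    (hτ : 0 ≤ τ) (hsmall : Real.exp (1 + τ) * ε * ((Δ : ℝ) + 1) ^ 2 ≤ 1 / 2) (C : Finset V) {m : ℝ} (hm : 0 < m) :
    ‖pertLogZ μ g R C - ∑ 𝒞 ∈ (rconnSubsets R C).powerset with ∑ Y ∈ 𝒞, (Y.card : ℝ) < m,
        truncatedWeight (GeomInc R) (connActivity R μ g) 𝒞‖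
      ≤ Real.exp (-(τ * m)) * (C.card * ((Δ : ℝ) + 1) * (2 * (Real.exp (1 + τ) * ε))) := by
  rw [pertLogZ_eq_sum_truncatedWeight, ← sum_filter_add_sum_filter_not ((rconnSubsets R C).powerset)
    (fun 𝒞 => ∑ Y ∈ 𝒞, (Y.card : ℝ) < m), add_sub_cancel_left]
  have hcongr : ((rconnSubsets R C).powerset.filter fun 𝒞 => ¬ ∑ Y ∈ 𝒞, (Y.card : ℝ) < m) =
      (rconnSubsets R C).powerset.filter fun 𝒞 => m ≤ ∑ Y ∈ 𝒞, (Y.card : ℝ) := filter_congr fun 𝒞 _ => not_lt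
  rw [hcongr]
  exact (norm_sum_le _ _).trans (act_sum_norm_truncatedWeight_large_le hR hΔ hnbr hact hε hτ hsmall C hm)

/-- **THE RETAINED TERMS ARE LOCAL**: the sum of the cluster terms of total size `< m` depends only on the activities of the `R`-connected
`K ⊆ C` with `#K < m` — two factor families whose activities agree there have the same small-cluster expansion. [folklore] -/
theorem smallClusters_congr (C : Finset V) (m : ℝ)
    (hagree : ∀ K : Finset V, K ⊆ C → IsRConnected R K → (K.card : ℝ) < m → cellActivity μ g K = cellActivity μ g' K) :
    ∑ 𝒞 ∈ (rconnSubsets R C).powerset with ∑ Y ∈ 𝒞, (Y.card : ℝ) < m, truncatedWeight (GeomInc R) (connActivity R μ g) 𝒞 =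
      ∑ 𝒞 ∈ (rconnSubsets R C).powerset with ∑ Y ∈ 𝒞, (Y.card : ℝ) < m, truncatedWeight (GeomInc R) (connActivity R μ g') 𝒞 := by
  refine sum_congr rfl fun 𝒞 h𝒞 => truncatedWeight_congr fun Y hY => ?_
  obtain ⟨h𝒞L, hsmall⟩ := mem_filter.1 h𝒞
  obtain ⟨hYC, hYconn⟩ := mem_rconnSubsets.1 (mem_powerset.1 h𝒞L hY)
  have hYm : (Y.card : ℝ) < m :=
    lt_of_le_of_lt (single_le_sum (f := fun Y : Finset V => (Y.card : ℝ)) (fun _ _ => Nat.cast_nonneg _) hY) hsmall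
  unfold connActivity
  simp only [hYconn, if_true]
  exact hagree Y hYC hYconn hYm

/-! ## §4. Toy -/

omit [DecidableEq V] [DecidableRel R] in
/-- Toy (§1): with `τ = 0` the decay smallness is the plain one. -/
example (hε : 0 ≤ ε) (hsmall : Real.exp (1 + 0) * ε * ((Δ : ℝ) + 1) ^ 2 ≤ 1 / 2) : Real.exp 1 * ε * ((Δ : ℝ) + 1) ^ 2 ≤ 1 / 2 :=
  smallness_of_decay hε le_rfl hsmall

end Summit.QuantumFields.BalabanUV.T4Continuum.NE7b.SupEffectiveActionLocalExpansion
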